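import Mathlib
import HarnessLib
import Summits.ValiantsHypothesis.ValiantsHypothesis.Theorems.SchenstedIndexWeightComponent

/-!
# Route SchenstedIndex — a balanced separating polynomial for `per_3` (step (b) of the
# completeness transfer for `BorderPcPerThree`, stmt-ValiantsHypothesis-16085)

`exists_balanced_separating_polynomial_perPoly_three`: there are `t : ℕ` and a polynomial `q` on the
coefficient space of `ℂ[x_ℓ : ℓ ∈ Fin 3 × Fin 3]` such that every monomial `∏_k c_(d_k)` of `q` uses only
degree-3 coordinates and has torus weight `∑_k d_k = t · J` (`J = ∑_ℓ e_ℓ`: every label used exactly `t`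
times — the monomials readable on 3-block partitions of the slot set `Fin t × Fin 3 × Fin 3`), `q`
vanishes at every width-3 power trace `tr(A_M³)` and `q(per_3) ≠ 0`.  Assembled from the separating
polynomial of step (a) with the tools of `SchenstedIndexWeightComponent.lean` (restriction to degree-3
coordinates, vanishing of torus-weight components, surviving monomial in permutation coordinates, coset
padding `P_τ + P_(cτ) + P_(c²τ) = J`).

Route-independent file.  HONEST FRAMING: bookkeeping for an OPEN support item; nothing on `VP ≠ VNP`.
-/

set_option linter.dupNamespace false

noncomputable section

namespace Summit.ValiantsHypothesis.ValiantsHypothesis.Theorems.SchenstedIndex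

open MvPolynomial Matrix
open Literature.Computability.AlgebraicComplexity

/-- **Step (b) of the completeness transfer: a balanced separating polynomial.** There are `t : ℕ`
and a polynomial `q` on the coefficient space of `ℂ[x_ℓ : ℓ ∈ Fin 3 × Fin 3]` such that every monomial
of `q` uses only degree-3 coordinates and has torus weight `t · J`, `q` vanishes at every width-3 power
trace `tr(A_M³)` and `q(per_3) ≠ 0`. -/
theorem exists_balanced_separating_polynomial_perPoly_three :
    ∃ t : ℕ, ∃ q : MvPolynomial ((Fin 3 × Fin 3) →₀ ℕ) ℂ,
      (∀ e ∈ q.support, (∀ d ∈ e.support, Finsupp.degree d = 3) ∧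
        Finsupp.weight (fun d : (Fin 3 × Fin 3) →₀ ℕ => d) e =
          t • ∑ ℓ : Fin 3 × Fin 3, Finsupp.single ℓ 1) ∧
      (∀ M : Fin 3 × Fin 3 → Matrix (Fin 3) (Fin 3) ℂ,
        aeval (coeffVec ((Matrix.of fun a b : Fin 3 => ∑ ℓ : Fin 3 × Fin 3,
          C (M ℓ a b) * (X ℓ : MvPolynomial (Fin 3 × Fin 3) ℂ)) ^ 3).trace) q = 0) ∧
      aeval (coeffVec (perPoly (Fin 3) ℂ)) q ≠ 0 := by
  classical
  obtain ⟨p, hp, hper⟩ := exists_separating_polynomial_perPoly_three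
  have haev : ∀ (v : ((Fin 3 × Fin 3) →₀ ℕ) → ℂ) (x : MvPolynomial ((Fin 3 × Fin 3) →₀ ℕ) ℂ),
      aeval v x = eval v x := fun v x => rfl
  -- (1) restrict `p` to the degree-3 coordinates
  set p' : MvPolynomial ((Fin 3 × Fin 3) →₀ ℕ) ℂ := bind₁ (fun d : (Fin 3 × Fin 3) →₀ ℕ =>
      if Finsupp.degree d = 3 then (X d : MvPolynomial ((Fin 3 × Fin 3) →₀ ℕ) ℂ) else 0) p
    with hp'
  have hvM0 : ∀ (M : Fin 3 × Fin 3 → Matrix (Fin 3) (Fin 3) ℂ) (d : (Fin 3 × Fin 3) →₀ ℕ),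
      Finsupp.degree d ≠ 3 →
      coeffVec ((Matrix.of fun a b : Fin 3 => ∑ ℓ : Fin 3 × Fin 3,
        C (M ℓ a b) * (X ℓ : MvPolynomial (Fin 3 × Fin 3) ℂ)) ^ 3).trace d = 0 := by
    intro M d hd
    rw [coeffVec_apply]
    exact (isHomogeneous_tracePow_pencil M 3).coeff_eq_zero hd
  have hvper0 : ∀ d : (Fin 3 × Fin 3) →₀ ℕ, Finsupp.degree d ≠ 3 →
      coeffVec (perPoly (Fin 3) ℂ) d = 0 := by
    intro d hd
    rw [coeffVec_apply]
    have h := perPoly_isHomogeneous (n := Fin 3) (k := ℂ)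
    rw [Fintype.card_fin] at h
    exact h.coeff_eq_zero hd
  have hp'M : ∀ M : Fin 3 × Fin 3 → Matrix (Fin 3) (Fin 3) ℂ,
      eval (coeffVec ((Matrix.of fun a b : Fin 3 => ∑ ℓ : Fin 3 × Fin 3,
        C (M ℓ a b) * (X ℓ : MvPolynomial (Fin 3 × Fin 3) ℂ)) ^ 3).trace) p' = 0 := by
    intro M
    rw [hp', eval_bind₁_degreeRestrict 3 p _ (hvM0 M), ← coe_aeval_eq_eval]
    exact hp M
  have hp'per : eval (coeffVec (perPoly (Fin 3) ℂ)) p' ≠ 0 := by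
    rw [hp', eval_bind₁_degreeRestrict 3 p _ hvper0, ← coe_aeval_eq_eval]
    exact hper
  -- (2) torus stability: every weight component of `p'` vanishes at every power trace
  have hcomp : ∀ (w : (Fin 3 × Fin 3) →₀ ℕ) (M : Fin 3 × Fin 3 → Matrix (Fin 3) (Fin 3) ℂ),
      eval (coeffVec ((Matrix.of fun a b : Fin 3 => ∑ ℓ : Fin 3 × Fin 3,
        C (M ℓ a b) * (X ℓ : MvPolynomial (Fin 3 × Fin 3) ℂ)) ^ 3).trace)
        (weightedHomogeneousComponent (fun d : (Fin 3 × Fin 3) →₀ ℕ => d) w p') = 0 := by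
    intro w M
    refine eval_weightedHomogeneousComponent_eq_zero_of_torus p' _ (fun lam => ?_) w
    have hpt : (fun d : (Fin 3 × Fin 3) →₀ ℕ => (∏ i, lam i ^ d i) *
        coeffVec ((Matrix.of fun a b : Fin 3 => ∑ ℓ : Fin 3 × Fin 3,
          C (M ℓ a b) * (X ℓ : MvPolynomial (Fin 3 × Fin 3) ℂ)) ^ 3).trace d) =
        coeffVec ((Matrix.of fun a b : Fin 3 => ∑ ℓ : Fin 3 × Fin 3,
          C (lam ℓ * M ℓ a b) * (X ℓ : MvPolynomial (Fin 3 × Fin 3) ℂ)) ^ 3).trace := by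
      funext d
      rw [coeffVec_tracePow_pencil_torus 3 M lam d]
    rw [hpt]
    have h := hp'M (fun ℓ => lam ℓ • M ℓ)
    simp only [Matrix.smul_apply, smul_eq_mul] at h
    exact h
  -- (3) a weight component surviving at `per_3`, with a monomial in permutation coordinates
  obtain ⟨w, e, _, hwe, hsupp, hw⟩ :=
    exists_weight_monomial_of_eval_ne_zero p' (coeffVec (perPoly (Fin 3) ℂ)) hp'per
  have hsub : e.support ⊆ Finset.univ.image (permMonomial (n := Fin 3)) := by
    intro d hd
    obtain ⟨ρ, hρ⟩ := exists_permMonomial_eq_of_coeff_perPoly_ne_zero ℂ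
      (by simpa only [coeffVec_apply] using hsupp d hd)
    exact Finset.mem_image.mpr ⟨ρ, Finset.mem_univ _, hρ⟩
  have hreindex : ∀ (N : Type) [AddCommMonoid N] (g : ((Fin 3 × Fin 3) →₀ ℕ) → ℕ → N),
      (∀ d, g d 0 = 0) →
      e.sum g = ∑ ρ : Equiv.Perm (Fin 3), g (permMonomial ρ) (e (permMonomial ρ)) := by
    intro N _ g hg
    rw [Finsupp.sum_of_support_subset e hsub g (fun d _ => hg d),
      Finset.sum_image (fun ρ _ ρ' _ h => permMonomial_injective h)]
  -- (4) the coset padding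
  set e' : ((Fin 3 × Fin 3) →₀ ℕ) →₀ ℕ := ∑ ρ : Equiv.Perm (Fin 3), e (permMonomial ρ) •
      ((Finsupp.single (permMonomial (ρ.trans (finRotate 3))) 1 : ((Fin 3 × Fin 3) →₀ ℕ) →₀ ℕ) +
        Finsupp.single (permMonomial (ρ.trans ((finRotate 3).trans (finRotate 3)))) 1) with he'
  refine ⟨Finsupp.degree e,
    weightedHomogeneousComponent (fun d : (Fin 3 × Fin 3) →₀ ℕ => d) w p' * monomial e' 1,
    ?_, ?_, ?_⟩
  · -- support: degree-3 coordinates, weight `(deg e) · J`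
    intro ε hε
    rw [mem_support_iff, coeff_mul_monomial', mul_one] at hε
    by_cases hle : e' ≤ ε
    · rw [if_pos hle] at hε
      have hεeq : ε = (ε - e') + e' := (tsub_add_cancel_of_le hle).symm
      have hε₁w : Finsupp.weight (fun d : (Fin 3 × Fin 3) →₀ ℕ => d) (ε - e') = w := by
        by_contra hne
        rw [coeff_weightedHomogeneousComponent, if_neg hne] at hε
        exact hε rfl
      have hε₁p' : ε - e' ∈ p'.support := by
        rw [coeff_weightedHomogeneousComponent, if_pos hε₁w] at hε
        exact mem_support_iff.mpr hε
      refine ⟨fun d hd => ?_, ?_⟩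
      · rw [hεeq] at hd
        rcases Finset.mem_union.mp (Finsupp.support_add hd) with hd1 | hd2
        · exact degree_eq_of_mem_support_bind₁_degreeRestrict 3 p hε₁p' hd1
        · obtain ⟨ρ, rfl⟩ := exists_permMonomial_eq_of_mem_support_padding _ hd2
          exact degree_permMonomial ρ
      · rw [hεeq, map_add, hε₁w, ← hwe, Finsupp.weight_apply,
          hreindex _ (fun d c => c • d) (fun d => zero_smul _ _), he', map_sum]
        simp_rw [map_nsmul, map_add, Finsupp.weight_single, one_smul]
        rw [← Finset.sum_add_distrib]
        have hdeg : Finsupp.degree e = ∑ ρ : Equiv.Perm (Fin 3), e (permMonomial ρ) := by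
          have h := hreindex ℕ (fun _ c => c) (fun _ => rfl)
          rw [← h]
          rfl
        rw [hdeg, Finset.sum_smul]
        refine Finset.sum_congr rfl fun ρ _ => ?_
        rw [← smul_add, ← add_assoc, permMonomial_coset_sum]
    · rw [if_neg hle] at hε
      exact absurd rfl hε
  · -- vanishing at every power trace
    intro M
    rw [haev, map_mul, hcomp w M, zero_mul]
  · -- non-vanishing at `per_3`
    rw [haev, map_mul]
    refine mul_ne_zero hw ?_
    rw [eval_monomial, one_mul, Finsupp.prod]
    refine Finset.prod_ne_zero_iff.mpr fun d hd => ?_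
    obtain ⟨ρ, rfl⟩ := exists_permMonomial_eq_of_mem_support_padding _ hd
    rw [coeffVec_apply, coeff_permMonomial_perPoly, one_pow]
    exact one_ne_zero

end Summit.ValiantsHypothesis.ValiantsHypothesis.Theorems.SchenstedIndex

end
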